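import Summits.AnomalousDissipation.AnomalousDissipation.Theorems.SolenoidalFractalHomogenisationLagrangianStepFrameToEulerianPhysical
import Summits.AnomalousDissipation.AnomalousDissipation.Theorems.SolenoidalFractalHomogenisationLagrangianStepCellTimeOrbits
import Summits.AnomalousDissipation.AnomalousDissipation.Theorems.SolenoidalFractalHomogenisationLagrangianStepOneLevelDefs
import Literature.Analysis.FunctionSpaces.TorusCalculusProofs
import Summits.AnomalousDissipation.AnomalousDissipation.Theorems.SolenoidalFractalHomogenisationLagrangianCarrierConstructionRegularLConjugation
import HarnessLib

/-!
# K1L_D (stmt-AnomalousDissipation-27980), `stub_Z7_alphaBeta` α-provider: the transfer hypotheses `hT1` of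
# `isDistortedPropagator_conjProp_clamped` for the TRUE and the COARSE member (helper; `--supports … --as helper`; lead-k1l-onelevel-p1 g5)

`isWeakTensorPassiveVectorOn_read_phys` (p704126) is (T1) in physical time for any Eulerian carrier `B` tied to the frame carrier `bc` by
`∇X · bc(σ₁+τ) = (1/a)(B − b_{≤m})(t′) ∘ X` on the open piece.  Here the relation is discharged for the two members of the glue's
`FrameConjugacyAt` (memo L12/L13):
* TRUE member: `bc = cellField W M hM (cellVisc (m+1)) _ (N (m+1))`, `B = partialSum (m+1)` — the relation IS `IsInserted`
  (`b_{m+1}(t′, X y) = ∇X(y) · level_{m+1}(t′, y)`, `t′` in the half-open window) with `(1/a) • level_{m+1}(jR + τ/a) = cellField τ`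
  (`CellTimeOrbits.smul_level_succ_comp_eq_cellField`); tensor `a • (1/N²)•(ν_c • S) = kbar (m+1) • S` (`ν_c = kbar N²/a`): **`hT1_true`**.
* COARSE member: `bc = 0`, `B = partialSum m` — the relation is `0 = 0`; tensor
  `a • (1/N²)•(ν_c•S + (c/ν_c)•Φ_ν((1/ν_c)•(ν_c•S))) = kbar m • renormStep (Φ ν_c) (c/ν_c²) S` by the Taylor recursion of `Permissible`:
  **`hT1_coarse`**.
Both are stated LITERALLY as the hypothesis `hT1` of `FrameConj.isDistortedPropagator_conjProp_clamped` (p701146) at `s = jR`, with the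
Eulerian data of the glue's binders (`Um1` along `partialSum (m+1)` with `kbar (m+1) • S`; `Um` along `partialSum m` with
`kbar m • renormStep …`).  NOT a proof of the stub, of the crux, or of AD; rung F-D1.A0.
-/

set_option linter.dupNamespace false  -- the summit-side namespace `Summit.AnomalousDissipation.AnomalousDissipation.…` repeats a component by design (D-0017)

noncomputable section

namespace Summit.AnomalousDissipation.AnomalousDissipation.Theorems.SolenoidalFractalHomogenisation.LagrangianStep.FrameConj

open Set Function Filter MeasureTheory Topology
open scoped NNReal ENNReal
open Literature.Analysis Literature.Analysis.FunctionSpaces Literature.Analysis.FunctionSpaces.Torus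
open Literature.Analysis.FluidPDE Literature.Analysis.FluidPDE.LatticeShear
open Literature.Analysis.FluidPDE.LatticeShear (LagrangianLatticeCarrier LatticeWord)
open Summit.AnomalousDissipation.AnomalousDissipation.Theorems.SolenoidalFractalHomogenisation.LagrangianStep.CellTime
  (smul_level_succ_comp_eq_cellField)
open Summit.AnomalousDissipation.AnomalousDissipation.Theorems.SolenoidalFractalHomogenisation.LagrangianRenormalisationStep (cellVisc_pos')
open Summit.AnomalousDissipation.AnomalousDissipation.Theorems.SolenoidalFractalHomogenisation.LagrangianCarrierConstruction (partialSum_succ_apply)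

variable {k : ℕ}

/-! ## §1 The carriers: weak solenoidality and `partialSum (m+1) = partialSum m + b (m+1)` -/

/-- The partial sums are weakly divergence free. -/
theorem isWeaklyDivFree_partialSum (E : LagrangianLatticeCarrier k) (hR : E.LevelRegular) (m : ℕ) (t : ℝ) :
    Torus.IsWeaklyDivFree (E.partialSum m t) :=
  Torus.IsDivFree.isWeaklyDivFree Torus.integral_inner_gradient_eq_neg_integral_mul_divergence_holds
    (hR.isSmooth_partialSum m t) (hR.isDivFree_partialSum m t)

/-! ## §2 The TRUE member: the relation is `IsInserted` -/

/-- **The carrier relation for the true member**: on the open piece, `∇X(y) · cellField(σ₁+τ)(y) = (1/a)(b_{≤m+1} − b_{≤m})(t′, X y)`. -/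
theorem flowDeriv_cellField_eq (E : LagrangianLatticeCarrier k) (hL : E.LPermissible) {W : LatticeWord k} {M : ℝ} {hM : 0 < M}
    (hdes : E.design = W.stretch M hM) (m j : ℕ) {t σ₁ : ℝ} (htR : t ≤ (j : ℝ) * E.refresh (m + 1) + E.refresh (m + 1))
    (hσ₁ : 0 ≤ σ₁) (hν : 0 < E.cellVisc (m + 1)) {τ : ℝ} (hτ : τ ∈ Ioo 0 (E.a (m + 1) * (t - (j : ℝ) * E.refresh (m + 1)) - σ₁))
    (y : UnitAddTorus (Fin 3)) :
    E.flowDeriv m ((j : ℝ) * E.refresh (m + 1) + (σ₁ + τ) / E.a (m + 1)) ((j : ℝ) * E.refresh (m + 1)) y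
        (cellField W M hM (E.cellVisc (m + 1)) hν (E.N (m + 1)) (σ₁ + τ) y)
      = (1 / E.a (m + 1)) • E.partialSum (m + 1) ((j : ℝ) * E.refresh (m + 1) + (σ₁ + τ) / E.a (m + 1))
          (E.X m ((j : ℝ) * E.refresh (m + 1) + (σ₁ + τ) / E.a (m + 1)) ((j : ℝ) * E.refresh (m + 1)) y)
        - (1 / E.a (m + 1)) • E.partialSum m ((j : ℝ) * E.refresh (m + 1) + (σ₁ + τ) / E.a (m + 1))
          (E.X m ((j : ℝ) * E.refresh (m + 1) + (σ₁ + τ) / E.a (m + 1)) ((j : ℝ) * E.refresh (m + 1)) y) := by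
  have ha : 0 < E.a (m + 1) := E.a_pos (m + 1)
  have ha' : E.a (m + 1) ≠ 0 := ha.ne'
  -- the flow time lies in the half-open window `j`
  have hwin : (j : ℝ) * E.refresh (m + 1) + (σ₁ + τ) / E.a (m + 1) ∈ E.window (m + 1) (j : ℤ) := by
    have h1 : 0 ≤ (σ₁ + τ) / E.a (m + 1) := div_nonneg (by linarith [hτ.1]) ha.le
    have h2 : (σ₁ + τ) / E.a (m + 1) < E.refresh (m + 1) := by
      rw [div_lt_iff₀ ha]
      have h3 := hτ.2
      nlinarith [mul_comm (E.a (m + 1)) (t - (j : ℝ) * E.refresh (m + 1))]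
    refine ⟨?_, ?_⟩ <;> push_cast <;> linarith
  have hIns := (hL.isLagrangian m).2 (j : ℤ) _ hwin y
  push_cast at hIns
  -- `cellField (σ₁+τ) = (1/a) • level (m+1) (t′)`
  have hcell := smul_level_succ_comp_eq_cellField E hL hdes m j (σ₁ + τ) y
  have et : (j : ℝ) * E.refresh (m + 1) + 1 / E.a (m + 1) * (σ₁ + τ) = (j : ℝ) * E.refresh (m + 1) + (σ₁ + τ) / E.a (m + 1) := by
    ring
  rw [et] at hcell
  rw [← hcell, map_smul, ← hIns, partialSum_succ_apply, smul_add, add_sub_cancel_left]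

/-- `a • (1/N²) • (ν_c • S) = kbar • S` (`ν_c = kbar N²/a`). -/
theorem smul_cellTensor_eq (E : LagrangianLatticeCarrier k) (m : ℕ) (S : FluidPDE.Torus.Visc4 (Fin 3)) :
    E.a (m + 1) • ((1 / (E.N (m + 1) : ℝ) ^ 2) • (E.cellVisc (m + 1) • S)) = E.kbar (m + 1) • S := by
  have ha : E.a (m + 1) ≠ 0 := (E.a_pos (m + 1)).ne'
  have hN : (E.N (m + 1) : ℝ) ≠ 0 := by have := E.N_pos (m + 1); positivity
  rw [smul_smul, smul_smul]
  congr 1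
  rw [show E.cellVisc (m + 1) = E.kbar (m + 1) * (E.N (m + 1) : ℝ) ^ 2 / E.a (m + 1) from rfl]
  field_simp

/-- **`hT1` for the TRUE member** (literally the hypothesis of `isDistortedPropagator_conjProp_clamped` with `s = jR`,
`bc = cellField …`, `𝔸c = (1/N²)•(ν_c•S)`, `B = partialSum (m+1)`, `𝔸E = kbar (m+1) • S`). -/
theorem hT1_true (E : LagrangianLatticeCarrier k) (hL : E.LPermissible) (hR : E.LevelRegular) {W : LatticeWord k} {M : ℝ}
    {hM : 0 < M} (hdes : E.design = W.stretch M hM) (m j : ℕ) {t : ℝ} (hjt : (j : ℝ) * E.refresh (m + 1) ≤ t)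
    (htR : t ≤ (j : ℝ) * E.refresh (m + 1) + E.refresh (m + 1)) (S : FluidPDE.Torus.Visc4 (Fin 3)) (hν : 0 < E.cellVisc (m + 1)) :
    ∀ σ₁ : ℝ, 0 ≤ σ₁ → σ₁ < E.a (m + 1) * (t - (j : ℝ) * E.refresh (m + 1)) →
      ∀ (φ : UnitAddTorus (Fin 3) → EuclideanSpace ℝ (Fin 3)), MemLp φ 2 volume →
      Torus.IsWeaklyDivFree (FluidPDE.Torus.distort
        (frameG E m ((j : ℝ) * E.refresh (m + 1) + σ₁ / E.a (m + 1)) ((j : ℝ) * E.refresh (m + 1))) φ) →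
      ∀ w : ℝ → UnitAddTorus (Fin 3) → EuclideanSpace ℝ (Fin 3),
      FluidPDE.Torus.IsWeakTensorPassiveVectorDistortedOn 0 (E.a (m + 1) * (t - (j : ℝ) * E.refresh (m + 1)) - σ₁)
        ((1 / (E.N (m + 1) : ℝ) ^ 2) • (E.cellVisc (m + 1) • S))
        (fun τ => cellField W M hM (E.cellVisc (m + 1)) hν (E.N (m + 1)) (σ₁ + τ))
        (fun τ y => frameG E m ((j : ℝ) * E.refresh (m + 1) +
          max 0 (min (σ₁ + τ) (E.a (m + 1) * (t - (j : ℝ) * E.refresh (m + 1)))) / E.a (m + 1)) ((j : ℝ) * E.refresh (m + 1)) y)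
        φ w →
      FluidPDE.Torus.IsWeakTensorPassiveVectorOn 0 (t - (j : ℝ) * E.refresh (m + 1) - σ₁ / E.a (m + 1)) (E.kbar (m + 1) • S)
        (fun τ' => E.partialSum (m + 1) ((j : ℝ) * E.refresh (m + 1) + σ₁ / E.a (m + 1) + τ'))
        (φ ∘ E.X m ((j : ℝ) * E.refresh (m + 1)) ((j : ℝ) * E.refresh (m + 1) + σ₁ / E.a (m + 1)))
        (fun τ' x => w (E.a (m + 1) * τ') (E.X m ((j : ℝ) * E.refresh (m + 1))
          ((j : ℝ) * E.refresh (m + 1) + σ₁ / E.a (m + 1) + τ') x)) := by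
  intro σ₁ hσ₁ hσ₁T φ hφ _ w hw
  have hF : E.IsFlow m := (hL.isLagrangian m).1
  have h := isWeakTensorPassiveVectorOn_read_phys E hR hF (j : ℤ) (t := t) (σ₁ := σ₁) (by push_cast; exact hjt)
    (by push_cast; exact htR) hσ₁ (by push_cast; exact hσ₁T.le)
    (𝔸c := (1 / (E.N (m + 1) : ℝ) ^ 2) • (E.cellVisc (m + 1) • S))
    (bc := cellField W M hM (E.cellVisc (m + 1)) hν (E.N (m + 1))) (B := E.partialSum (m + 1))
    (hR.continuous_uncurry_partialSum (m + 1)) (fun t' => isWeaklyDivFree_partialSum E hR (m + 1) t')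
    (by push_cast; exact fun τ hτ y => flowDeriv_cellField_eq E hL hdes m j htR hσ₁ hν hτ y) hφ
    (by push_cast; exact hw)
  push_cast at h
  rw [smul_cellTensor_eq] at h
  exact h

/-! ## §3 The COARSE member: no frame drift -/

/-- `(1/ν) • (ν • S) = S`. -/
theorem inv_smul_smul_visc {ν : ℝ} (hν : 0 < ν) (S : FluidPDE.Torus.Visc4 (Fin 3)) : (1 / ν) • (ν • S) = S := by
  rw [smul_smul, one_div_mul_cancel hν.ne', one_smul]

/-- The coarse tensor identity: `a • (1/N²)•(ν_c•S + (c/ν_c)•Φ(S)) = kbar m • renormStep Φ (c/ν_c²) S` under the Taylor recursion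
`kbar m = kbar (m+1)·(1 + c a²/(kbar (m+1)² N⁴))` of `Permissible`. -/
theorem smul_coarseTensor_eq (E : LagrangianLatticeCarrier k) (hL : E.LPermissible) (m : ℕ)
    (Ψ : FluidPDE.Torus.Visc4 (Fin 3) → FluidPDE.Torus.Visc4 (Fin 3)) (S : FluidPDE.Torus.Visc4 (Fin 3)) :
    E.a (m + 1) • ((1 / (E.N (m + 1) : ℝ) ^ 2) • (E.cellVisc (m + 1) • S + (E.gain / E.cellVisc (m + 1)) • Ψ S))
      = E.kbar m • renormStep Ψ (E.gain / E.cellVisc (m + 1) ^ 2) S := by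
  have ha : E.a (m + 1) ≠ 0 := (E.a_pos (m + 1)).ne'
  have hN : (E.N (m + 1) : ℝ) ≠ 0 := by have := E.N_pos (m + 1); positivity
  have hk : E.kbar (m + 1) ≠ 0 := (E.kbar_pos (m + 1)).ne'
  have hνdef : E.cellVisc (m + 1) = E.kbar (m + 1) * (E.N (m + 1) : ℝ) ^ 2 / E.a (m + 1) := rfl
  have hrec : E.kbar m = E.kbar (m + 1) * (1 + E.gain * E.a (m + 1) ^ 2 / (E.kbar (m + 1) ^ 2 * (E.N (m + 1) : ℝ) ^ 4)) :=
    hL.permissible.2.2.2.1 m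
  set g : ℝ := E.gain / E.cellVisc (m + 1) ^ 2 with hg
  have hg0 : 0 ≤ g := div_nonneg E.gain_pos.le (sq_nonneg _)
  have hg1 : 1 + g ≠ 0 := by linarith
  have hg' : g = E.gain * E.a (m + 1) ^ 2 / (E.kbar (m + 1) ^ 2 * (E.N (m + 1) : ℝ) ^ 4) := by
    rw [hg, hνdef]; field_simp
  have hrec' : E.kbar m = E.kbar (m + 1) * (1 + g) := by rw [hrec, hg']
  -- the two scalar coefficients
  have e1 : E.kbar m * (1 / (1 + g)) = E.kbar (m + 1) := by rw [hrec']; field_simp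
  have e2 : E.kbar m * (1 / (1 + g) * g) = E.kbar (m + 1) * g := by rw [hrec']; field_simp
  have e3 : E.a (m + 1) * (1 / (E.N (m + 1) : ℝ) ^ 2 * E.cellVisc (m + 1)) = E.kbar (m + 1) := by
    rw [hνdef]; field_simp
  have e4 : E.a (m + 1) * (1 / (E.N (m + 1) : ℝ) ^ 2 * (E.gain / E.cellVisc (m + 1))) = E.kbar (m + 1) * g := by
    rw [hg', hνdef]; field_simp
  unfold renormStep
  simp only [smul_add, smul_smul]
  rw [e1, e2, e3, e4]

/-- **`hT1` for the COARSE member** (`bc = 0`, `𝔸c = (1/N²)•(ν_c•S + (c/ν_c)•Φ_ν((1/ν_c)•(ν_c•S)))`, `B = partialSum m`,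
`𝔸E = kbar m • renormStep (Φ ν_c) (c/ν_c²) S`, `c = E.gain`). -/
theorem hT1_coarse (E : LagrangianLatticeCarrier k) (hL : E.LPermissible) (hR : E.LevelRegular) (m j : ℕ) {t : ℝ}
    (hjt : (j : ℝ) * E.refresh (m + 1) ≤ t) (htR : t ≤ (j : ℝ) * E.refresh (m + 1) + E.refresh (m + 1))
    (Φ : ℝ → FluidPDE.Torus.Visc4 (Fin 3) → FluidPDE.Torus.Visc4 (Fin 3)) (S : FluidPDE.Torus.Visc4 (Fin 3)) :
    ∀ σ₁ : ℝ, 0 ≤ σ₁ → σ₁ < E.a (m + 1) * (t - (j : ℝ) * E.refresh (m + 1)) →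
      ∀ (φ : UnitAddTorus (Fin 3) → EuclideanSpace ℝ (Fin 3)), MemLp φ 2 volume →
      Torus.IsWeaklyDivFree (FluidPDE.Torus.distort
        (frameG E m ((j : ℝ) * E.refresh (m + 1) + σ₁ / E.a (m + 1)) ((j : ℝ) * E.refresh (m + 1))) φ) →
      ∀ w : ℝ → UnitAddTorus (Fin 3) → EuclideanSpace ℝ (Fin 3),
      FluidPDE.Torus.IsWeakTensorPassiveVectorDistortedOn 0 (E.a (m + 1) * (t - (j : ℝ) * E.refresh (m + 1)) - σ₁)
        ((1 / (E.N (m + 1) : ℝ) ^ 2) • (E.cellVisc (m + 1) • S +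
          (E.gain / E.cellVisc (m + 1)) • Φ (E.cellVisc (m + 1)) ((1 / E.cellVisc (m + 1)) • (E.cellVisc (m + 1) • S))))
        (fun τ => (fun (_ : ℝ) (_ : UnitAddTorus (Fin 3)) => (0 : EuclideanSpace ℝ (Fin 3))) (σ₁ + τ))
        (fun τ y => frameG E m ((j : ℝ) * E.refresh (m + 1) +
          max 0 (min (σ₁ + τ) (E.a (m + 1) * (t - (j : ℝ) * E.refresh (m + 1)))) / E.a (m + 1)) ((j : ℝ) * E.refresh (m + 1)) y)
        φ w →
      FluidPDE.Torus.IsWeakTensorPassiveVectorOn 0 (t - (j : ℝ) * E.refresh (m + 1) - σ₁ / E.a (m + 1))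
        (E.kbar m • renormStep (Φ (E.cellVisc (m + 1))) (E.gain / E.cellVisc (m + 1) ^ 2) S)
        (fun τ' => E.partialSum m ((j : ℝ) * E.refresh (m + 1) + σ₁ / E.a (m + 1) + τ'))
        (φ ∘ E.X m ((j : ℝ) * E.refresh (m + 1)) ((j : ℝ) * E.refresh (m + 1) + σ₁ / E.a (m + 1)))
        (fun τ' x => w (E.a (m + 1) * τ') (E.X m ((j : ℝ) * E.refresh (m + 1))
          ((j : ℝ) * E.refresh (m + 1) + σ₁ / E.a (m + 1) + τ') x)) := by
  intro σ₁ hσ₁ hσ₁T φ hφ _ w hw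
  have hF : E.IsFlow m := (hL.isLagrangian m).1
  have hνpos : 0 < E.cellVisc (m + 1) := cellVisc_pos' E.toFractalCarrierData (m + 1)
  have hrel : ∀ τ ∈ Ioo 0 (E.a (m + 1) * (t - ((j : ℤ) : ℝ) * E.refresh (m + 1)) - σ₁), ∀ y,
      E.flowDeriv m (((j : ℤ) : ℝ) * E.refresh (m + 1) + (σ₁ + τ) / E.a (m + 1)) (((j : ℤ) : ℝ) * E.refresh (m + 1)) y
        ((fun (_ : ℝ) (_ : UnitAddTorus (Fin 3)) => (0 : EuclideanSpace ℝ (Fin 3))) (σ₁ + τ) y)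
      = (1 / E.a (m + 1)) • E.partialSum m (((j : ℤ) : ℝ) * E.refresh (m + 1) + (σ₁ + τ) / E.a (m + 1))
          (E.X m (((j : ℤ) : ℝ) * E.refresh (m + 1) + (σ₁ + τ) / E.a (m + 1)) (((j : ℤ) : ℝ) * E.refresh (m + 1)) y)
        - (1 / E.a (m + 1)) • E.partialSum m (((j : ℤ) : ℝ) * E.refresh (m + 1) + (σ₁ + τ) / E.a (m + 1))
          (E.X m (((j : ℤ) : ℝ) * E.refresh (m + 1) + (σ₁ + τ) / E.a (m + 1)) (((j : ℤ) : ℝ) * E.refresh (m + 1)) y) :=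
    fun τ _ y => by rw [map_zero, sub_self]
  have h := isWeakTensorPassiveVectorOn_read_phys E hR hF (j : ℤ) (t := t) (σ₁ := σ₁) (by push_cast; exact hjt)
    (by push_cast; exact htR) hσ₁ (by push_cast; exact hσ₁T.le)
    (𝔸c := (1 / (E.N (m + 1) : ℝ) ^ 2) • (E.cellVisc (m + 1) • S +
      (E.gain / E.cellVisc (m + 1)) • Φ (E.cellVisc (m + 1)) ((1 / E.cellVisc (m + 1)) • (E.cellVisc (m + 1) • S))))
    (bc := fun (_ : ℝ) (_ : UnitAddTorus (Fin 3)) => (0 : EuclideanSpace ℝ (Fin 3))) (B := E.partialSum m)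
    (hR.continuous_uncurry_partialSum m) (fun t' => isWeaklyDivFree_partialSum E hR m t') hrel hφ (by push_cast; exact hw)
  push_cast at h
  rw [inv_smul_smul_visc hνpos, smul_coarseTensor_eq E hL m (Φ (E.cellVisc (m + 1))) S] at h
  exact h

end Summit.AnomalousDissipation.AnomalousDissipation.Theorems.SolenoidalFractalHomogenisation.LagrangianStep.FrameConj

end
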